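import Literature.Analysis.PDE.HeatDuhamelSobolev
import HarnessLib

/-!
# Sobolev-energy estimates of every order for the free heat flow (topic `Analysis/PDE`)

Analytic layer of the programme to prove short-time existence for quasilinear strictly
parabolic systems on a closed manifold (hypothesis `hQL` of
`Literature.Geometry.Riemannian.ricciFlow_shortTime_existence_of_quasilinear`). Companion of
`HeatDuhamelSobolev.lean` for the free flow `freeFlow ν k₀ t = e^{νtΔ}k₀` on admissible data
(`HeatFreeFlowAdmissible.lean`): the order-`0` facts — the `L²` contraction
`‖e^{νtΔ}k₀‖₂ ≤ ‖k₀‖₂` and the energy inequality `∫∫_{(0,T) × E}|∇e^{ντΔ}k₀|² ≤ ‖k₀‖₂²/ν` — are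
lifted to every Sobolev order `k` in the currency of `sobolevEnergy k`:

* `sobolevEnergy_freeFlow_le` — `E_k(e^{νtΔ}k₀) ≤ E_k(k₀)` for all `t`;
* `lintegral_sum_sobolevEnergy_fderiv_freeFlow_le` —
  `∫_0^T Σᵢ E_k(∂ᵢ e^{νtΔ}k₀) dt ≤ E_k(k₀)/ν`.

Tools: joint smoothness of the free flow on `t > 0` (`isSmoothSpaceTimeOn_freeFlow`, from the
tree's `contDiffOn_heatExtension_prod`), a.e.-measurability in time of slice energies of fields
smooth on an open time set (`aemeasurable_sobolevEnergy_slice`), Tonelli, and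
`∫⁻‖f‖ₑ² = ‖f‖₂²` (`lintegral_enorm_sq_eq_eLpNorm_sq`).

Everything is proved; no named fact and no `sorry` is introduced.

## References

* P. G. Lemarié-Rieusset, *The Navier–Stokes problem in the 21st century*, CRC Press 2016,
  Prop. 4.3 (A), p. 74. [LemarieRieusset2016]
* L. C. Evans, *Partial Differential Equations*, 2nd ed., AMS 2010, §2.3.1, Thm. 1; §7.1.3.
  [Evans2010]
-/

noncomputable section

open MeasureTheory Set Function Filter Topology TopologicalSpace Metric InnerProductSpace
open scoped RealInnerProductSpace Laplacian ContDiff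

namespace Literature.Analysis.PDE

open Literature.Analysis.UnboundedOperators Literature.Analysis.FluidPDE
  Literature.Analysis.FunctionSpaces

variable {E : Type*} [NormedAddCommGroup E] [InnerProductSpace ℝ E] [FiniteDimensional ℝ E]
  [MeasurableSpace E] [BorelSpace E]
variable {F' : Type*} [NormedAddCommGroup F'] [InnerProductSpace ℝ F'] [FiniteDimensional ℝ F']

/-! ### Measurability of slice energies on an open time set -/

omit [FiniteDimensional ℝ F'] in
/-- The slice energies of a field jointly smooth on an open time set `S` are a.e.-measurable
for Lebesgue measure restricted to `S`. [folklore] -/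
theorem aemeasurable_sobolevEnergy_slice {S : Set ℝ} (hS : IsOpen S) (k : ℕ) :
    ∀ {F : ℝ → E → F'}, IsSmoothSpaceTimeOn S F →
      AEMeasurable (fun t ↦ sobolevEnergy k (F t)) (volume.restrict S) := by
  induction k with
  | zero =>
    intro F hF
    simp only [sobolevEnergy_zero_left]
    have hc : ContinuousOn (fun p : ℝ × E ↦ ‖F p.1 p.2‖ₑ ^ 2) (S ×ˢ univ) :=
      (ENNReal.continuous_pow 2).comp_continuousOn (continuous_enorm.comp_continuousOn hF.continuousOn)
    have hm : AEMeasurable (fun p : ℝ × E ↦ ‖F p.1 p.2‖ₑ ^ 2)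
        ((volume.restrict S).prod (volume : Measure E)) := by
      have h := hc.aemeasurable (μ := (volume : Measure ℝ).prod (volume : Measure E))
        (hS.measurableSet.prod MeasurableSet.univ)
      rwa [← Measure.prod_restrict, Measure.restrict_univ] at h
    exact hm.lintegral_prod_right'
  | succ k ih =>
    intro F hF
    simp only [sobolevEnergy_succ]
    refine AEMeasurable.add ?_ (Finset.aemeasurable_fun_sum _ fun i _ ↦ ?_)
    · have hc : ContinuousOn (fun p : ℝ × E ↦ ‖F p.1 p.2‖ₑ ^ 2) (S ×ˢ univ) :=
        (ENNReal.continuous_pow 2).comp_continuousOn (continuous_enorm.comp_continuousOn hF.continuousOn)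
      have hm : AEMeasurable (fun p : ℝ × E ↦ ‖F p.1 p.2‖ₑ ^ 2)
          ((volume.restrict S).prod (volume : Measure E)) := by
        have h := hc.aemeasurable (μ := (volume : Measure ℝ).prod (volume : Measure E))
          (hS.measurableSet.prod MeasurableSet.univ)
        rwa [← Measure.prod_restrict, Measure.restrict_univ] at h
      exact hm.lintegral_prod_right'
    · exact ih (hF.isSmoothSpaceTimeOn_fderiv_apply hS _)

/-! ### The free flow is jointly smooth on `t > 0` -/

variable {ν : ℝ} {k₀ : E → F'}

omit [FiniteDimensional ℝ F'] in
/-- The free flow of an admissible datum is jointly `C^∞` on `(0, ∞) × E`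
(`contDiffOn_heatExtension_prod` and the time scaling `t ↦ νt`). [folklore] -/
theorem isSmoothSpaceTimeOn_freeFlow (hk₀ : IsHeatAdmissible k₀) (hν : 0 < ν) :
    IsSmoothSpaceTimeOn (Ioi 0) (freeFlow ν k₀) := by
  have h := contDiffOn_heatExtension_prod (hk₀.memLp_two) one_le_two
  have hφ : ContDiff ℝ ∞ fun p : ℝ × E ↦ ((ν * p.1, p.2) : ℝ × E) :=
    (contDiff_const.mul contDiff_fst).prodMk contDiff_snd
  have hmaps : MapsTo (fun p : ℝ × E ↦ ((ν * p.1, p.2) : ℝ × E)) (Ioi 0 ×ˢ univ) (Ioi 0 ×ˢ univ) :=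
    fun p hp ↦ ⟨mul_pos hν (mem_prod.1 hp).1, mem_univ _⟩
  have hcomp := h.comp hφ.contDiffOn hmaps
  refine hcomp.congr ?_
  rintro ⟨t, x⟩ hp
  have ht : 0 < t := (mem_prod.1 hp).1
  simp [uncurry, freeFlow, ht]

/-! ### `∫⁻ ‖f‖ₑ² = ‖f‖₂²` -/

omit [InnerProductSpace ℝ F'] [FiniteDimensional ℝ F'] in
/-- `∫⁻ ‖f‖ₑ² = (eLpNorm f 2)²`. [folklore] -/
theorem lintegral_enorm_sq_eq_eLpNorm_sq (f : E → F') :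
    ∫⁻ x, ‖f x‖ₑ ^ 2 = eLpNorm f 2 volume ^ 2 := by
  have h := eLpNorm_nnreal_pow_eq_lintegral (f := f) (μ := (volume : Measure E)) (p := 2) two_ne_zero
  have h2 : ((2 : NNReal) : ℝ) = ((2 : ℕ) : ℝ) := by norm_num
  rw [show ((2 : NNReal) : ENNReal) = 2 from rfl, h2, ENNReal.rpow_natCast] at h
  rw [h]
  refine lintegral_congr fun x ↦ ?_
  rw [ENNReal.rpow_natCast]

/-! ### Contraction at every order -/

/-- **`L²` contraction at every order**: `E_k(e^{νtΔ}k₀) ≤ E_k(k₀)` for admissible `k₀` and all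
`t`. [cite: LemarieRieusset2016, Prop. 4.3 (A)] -/
theorem sobolevEnergy_freeFlow_le (hν : 0 < ν) (k : ℕ) :
    ∀ {k₀ : E → F'}, IsHeatAdmissible k₀ → ∀ t : ℝ,
      sobolevEnergy k (freeFlow ν k₀ t) ≤ sobolevEnergy k k₀ := by
  induction k with
  | zero =>
    intro k₀ hk₀ t
    simp only [sobolevEnergy_zero_left, lintegral_enorm_sq_eq_eLpNorm_sq]
    exact pow_le_pow_left' (eLpNorm_freeFlow_le hk₀ hν t) 2
  | succ k ih =>
    intro k₀ hk₀ t
    rw [sobolevEnergy_succ, sobolevEnergy_succ]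
    refine add_le_add ?_ (Finset.sum_le_sum fun i _ ↦ ?_)
    · rw [lintegral_enorm_sq_eq_eLpNorm_sq, lintegral_enorm_sq_eq_eLpNorm_sq]
      exact pow_le_pow_left' (eLpNorm_freeFlow_le hk₀ hν t) 2
    · have heq : (fun x ↦ fderiv ℝ (freeFlow ν k₀ t) x (stdOrthonormalBasis ℝ E i)) =
          freeFlow ν (fun y ↦ fderiv ℝ k₀ y (stdOrthonormalBasis ℝ E i)) t :=
        funext fun x ↦ fderiv_freeFlow_apply hk₀ hν t x _
      rw [heq]
      exact ih (hk₀.fderiv_apply _) t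

/-! ### The energy inequality at every order -/

omit [FiniteDimensional ℝ F'] in
/-- Schwarz for admissible data: `∂ₗ∂ᵢk₀ = ∂ᵢ∂ₗk₀`. [folklore] -/
theorem IsHeatAdmissible.fderiv_fderiv_comm (hk₀ : IsHeatAdmissible k₀) (v w : E) :
    (fun y ↦ fderiv ℝ (fun z ↦ fderiv ℝ k₀ z v) y w) =
      fun y ↦ fderiv ℝ (fun z ↦ fderiv ℝ k₀ z w) y v := by
  have h := iterDirDeriv_singleton_comm hk₀.contDiff w v
  simpa [FunctionSpaces.iterDirDeriv] using h

/-- Order `0`: `∫_0^T Σᵢ ∫⁻‖∂ᵢe^{νtΔ}k₀‖ₑ² ≤ ‖k₀‖₂²/ν` (Tonelli on the scaled energy inequality).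
[cite: LemarieRieusset2016, Prop. 4.3 (A)] -/
theorem lintegral_sum_lintegral_enorm_sq_fderiv_freeFlow_le (hk₀ : IsHeatAdmissible k₀)
    (hν : 0 < ν) (T : ℝ) :
    ∫⁻ t in Ioo 0 T, ∑ i, ∫⁻ x, ‖fderiv ℝ (freeFlow ν k₀ t) x (stdOrthonormalBasis ℝ E i)‖ₑ ^ 2 ≤
      ENNReal.ofReal ν⁻¹ * sobolevEnergy 0 k₀ := by
  have hsm := isSmoothSpaceTimeOn_freeFlow hk₀ hν
  -- the integrand as a function on the product
  set G : ℝ × E → ENNReal := fun z ↦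
    ∑ i, ‖fderiv ℝ (freeFlow ν k₀ z.1) z.2 (stdOrthonormalBasis ℝ E i)‖ₑ ^ 2 with hG
  have hGc : ContinuousOn G (Ioi 0 ×ˢ univ) := by
    refine continuousOn_finsetSum _ fun i _ ↦ ?_
    have h := (hsm.isSmoothSpaceTimeOn_fderiv_apply isOpen_Ioi (stdOrthonormalBasis ℝ E i)).continuousOn
    exact (ENNReal.continuous_pow 2).comp_continuousOn (continuous_enorm.comp_continuousOn h)
  have hGm : AEMeasurable G ((volume.restrict (Ioo 0 T)).prod (volume : Measure E)) := by
    have h := (hGc.mono (prod_mono (fun z (hz : z ∈ Ioo (0 : ℝ) T) ↦ (hz.1 : z ∈ Ioi (0 : ℝ))) le_rfl)).aemeasurable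
      (μ := (volume : Measure ℝ).prod (volume : Measure E))
      ((measurableSet_Ioo (a := (0 : ℝ)) (b := T)).prod MeasurableSet.univ)
    rwa [← Measure.prod_restrict, Measure.restrict_univ] at h
  -- Tonelli
  have hR : ∫⁻ z in Ioo 0 T ×ˢ (univ : Set E), G z =
      ∫⁻ z, G z ∂((volume.restrict (Ioo 0 T)).prod (volume : Measure E)) := by
    rw [Measure.volume_eq_prod, ← Measure.prod_restrict, Measure.restrict_univ]
  have hslice : ∀ t i, AEMeasurable
      (fun x ↦ ‖fderiv ℝ (freeFlow ν k₀ t) x (stdOrthonormalBasis ℝ E i)‖ₑ ^ 2) volume := by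
    intro t i
    have heq : (fun x ↦ fderiv ℝ (freeFlow ν k₀ t) x (stdOrthonormalBasis ℝ E i)) =
        freeFlow ν (fun y ↦ fderiv ℝ k₀ y (stdOrthonormalBasis ℝ E i)) t :=
      funext fun x ↦ fderiv_freeFlow_apply hk₀ hν t x _
    have hc : Continuous fun x ↦ fderiv ℝ (freeFlow ν k₀ t) x (stdOrthonormalBasis ℝ E i) := by
      rw [heq]
      exact ((hk₀.fderiv_apply _).freeFlow hν t).contDiff.continuous
    exact ((ENNReal.continuous_pow 2).comp (continuous_enorm.comp hc)).aemeasurable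
  have htonelli : ∫⁻ t in Ioo 0 T, ∑ i, ∫⁻ x,
      ‖fderiv ℝ (freeFlow ν k₀ t) x (stdOrthonormalBasis ℝ E i)‖ₑ ^ 2 =
      ∫⁻ z in Ioo 0 T ×ˢ (univ : Set E), G z := by
    rw [hR, lintegral_prod _ hGm]
    refine lintegral_congr fun t ↦ ?_
    rw [lintegral_finsetSum' _ fun i _ ↦ hslice t i]
  -- the integrand is `ofReal (frobeniusNormSq)`
  have hfrob : ∀ z : ℝ × E, G z =
      ENNReal.ofReal (frobeniusNormSq (fderiv ℝ (freeFlow ν k₀ z.1) z.2)) := fun z ↦ by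
    rw [hG, frobeniusNormSq, ENNReal.ofReal_sum_of_nonneg fun i _ ↦ sq_nonneg _]
    exact Finset.sum_congr rfl fun i _ ↦ enorm_sq_eq_ofReal _
  rw [htonelli, lintegral_congr fun z ↦ hfrob z, sobolevEnergy_zero_left,
    lintegral_enorm_sq_eq_eLpNorm_sq]
  exact lintegral_prod_frobeniusNormSq_fderiv_freeFlow_le hk₀ hν T

/-- **The energy inequality of the free flow at every order**:
`∫_0^T Σᵢ E_k(∂ᵢ e^{νtΔ}k₀) dt ≤ E_k(k₀)/ν` for admissible `k₀`.
[cite: LemarieRieusset2016, Prop. 4.3 (A)] -/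
theorem lintegral_sum_sobolevEnergy_fderiv_freeFlow_le (hν : 0 < ν) (k : ℕ) :
    ∀ {k₀ : E → F'}, IsHeatAdmissible k₀ → ∀ T : ℝ,
      ∫⁻ t in Ioo 0 T, ∑ i, sobolevEnergy k
          (fun x ↦ fderiv ℝ (freeFlow ν k₀ t) x (stdOrthonormalBasis ℝ E i)) ≤
        ENNReal.ofReal ν⁻¹ * sobolevEnergy k k₀ := by
  induction k with
  | zero =>
    intro k₀ hk₀ T
    simp only [sobolevEnergy_zero_left]
    have h := lintegral_sum_lintegral_enorm_sq_fderiv_freeFlow_le hk₀ hν T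
    simpa only [sobolevEnergy_zero_left] using h
  | succ k ih =>
    intro k₀ hk₀ T
    have hsm := isSmoothSpaceTimeOn_freeFlow hk₀ hν
    have hsmi : ∀ i, IsSmoothSpaceTimeOn (Ioi 0)
        (fun t x ↦ fderiv ℝ (freeFlow ν k₀ t) x (stdOrthonormalBasis ℝ E i)) :=
      fun i ↦ hsm.isSmoothSpaceTimeOn_fderiv_apply isOpen_Ioi _
    -- measurability in time on `(0, T)`
    have hmono : (volume.restrict (Ioo 0 T) : Measure ℝ) ≤ volume.restrict (Ioi 0) :=
      Measure.restrict_mono (fun z (hz : z ∈ Ioo (0 : ℝ) T) ↦ (hz.1 : z ∈ Ioi (0 : ℝ))) le_rfl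
    have hmeas0 : ∀ i, AEMeasurable (fun t ↦ ∫⁻ x,
        ‖fderiv ℝ (freeFlow ν k₀ t) x (stdOrthonormalBasis ℝ E i)‖ₑ ^ 2) (volume.restrict (Ioo 0 T)) :=
      fun i ↦ by
      have h := aemeasurable_sobolevEnergy_slice isOpen_Ioi 0 (hsmi i)
      simp only [sobolevEnergy_zero_left] at h
      exact h.mono_measure hmono
    have hmeask : ∀ i l, AEMeasurable (fun t ↦ sobolevEnergy k (fun x ↦ fderiv ℝ
        (fun y ↦ fderiv ℝ (freeFlow ν k₀ t) y (stdOrthonormalBasis ℝ E i)) x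
          (stdOrthonormalBasis ℝ E l))) (volume.restrict (Ioo 0 T)) := fun i l ↦
      (aemeasurable_sobolevEnergy_slice isOpen_Ioi k
        ((hsmi i).isSmoothSpaceTimeOn_fderiv_apply isOpen_Ioi _)).mono_measure hmono
    rw [sobolevEnergy_succ, mul_add, Finset.mul_sum]
    simp only [sobolevEnergy_succ]
    have hsplit : ∫⁻ t in Ioo 0 T, ∑ i, ((∫⁻ x,
        ‖fderiv ℝ (freeFlow ν k₀ t) x (stdOrthonormalBasis ℝ E i)‖ₑ ^ 2) +
          ∑ l, sobolevEnergy k (fun x ↦ fderiv ℝ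
            (fun y ↦ fderiv ℝ (freeFlow ν k₀ t) y (stdOrthonormalBasis ℝ E i)) x
              (stdOrthonormalBasis ℝ E l))) =
        (∫⁻ t in Ioo 0 T, ∑ i, ∫⁻ x,
          ‖fderiv ℝ (freeFlow ν k₀ t) x (stdOrthonormalBasis ℝ E i)‖ₑ ^ 2) +
          ∑ l, ∫⁻ t in Ioo 0 T, ∑ i, sobolevEnergy k (fun x ↦ fderiv ℝ
            (fun y ↦ fderiv ℝ (freeFlow ν k₀ t) y (stdOrthonormalBasis ℝ E i)) x
              (stdOrthonormalBasis ℝ E l)) := by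
      rw [← lintegral_finsetSum' _ fun l _ ↦ Finset.aemeasurable_fun_sum _ fun i _ ↦ hmeask i l,
        ← lintegral_add_left' (Finset.aemeasurable_fun_sum _ fun i _ ↦ hmeas0 i)]
      refine lintegral_congr fun t ↦ ?_
      rw [Finset.sum_add_distrib, Finset.sum_comm]
    rw [hsplit]
    refine add_le_add ?_ (Finset.sum_le_sum fun l _ ↦ ?_)
    · have h := lintegral_sum_lintegral_enorm_sq_fderiv_freeFlow_le hk₀ hν T
      simpa only [sobolevEnergy_zero_left] using h
    · have heq : ∀ t i, (fun x ↦ fderiv ℝ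
          (fun y ↦ fderiv ℝ (freeFlow ν k₀ t) y (stdOrthonormalBasis ℝ E i)) x
            (stdOrthonormalBasis ℝ E l)) =
          fun x ↦ fderiv ℝ (freeFlow ν (fun y ↦ fderiv ℝ k₀ y (stdOrthonormalBasis ℝ E l)) t) x
            (stdOrthonormalBasis ℝ E i) := by
        intro t i
        have h1 : (fun y ↦ fderiv ℝ (freeFlow ν k₀ t) y (stdOrthonormalBasis ℝ E i)) =
            freeFlow ν (fun y ↦ fderiv ℝ k₀ y (stdOrthonormalBasis ℝ E i)) t :=
          funext fun y ↦ fderiv_freeFlow_apply hk₀ hν t y _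
        rw [h1]
        have h2 := funext fun x ↦ fderiv_freeFlow_apply (hk₀.fderiv_apply (stdOrthonormalBasis ℝ E i))
          hν t x (stdOrthonormalBasis ℝ E l)
        rw [h2]
        have h3 := funext fun x ↦ fderiv_freeFlow_apply (hk₀.fderiv_apply (stdOrthonormalBasis ℝ E l))
          hν t x (stdOrthonormalBasis ℝ E i)
        rw [h3, hk₀.fderiv_fderiv_comm]
      simp only [heq]
      exact ih (hk₀.fderiv_apply _) T

end Literature.Analysis.PDE

end
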